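import Summits.CriticalPhenomena.PercolationContinuityZ3.Theorems.Transplant.SkelFrmFrom1RootHoldsQDKVOfLe
import Summits.CriticalPhenomena.PercolationContinuityZ3.Theorems.Transplant.SkelFrmFrom1RootHoldsQDKVPx
import Summits.CriticalPhenomena.PercolationContinuityZ3.Theorems.Transplant.SkelFrmFromBChoiceBridge0Px
import Summits.CriticalPhenomena.PercolationContinuityZ3.Theorems.Transplant.SkelFrmFrom1RootHoldsQCKVOfLePx
import HarnessLib

/-!
# U_s execution (RULING D-Us / Us-R3, lead g22 2026-08-26; WAVE-Us-MANIFEST v1.0 §3 GEN row «SkelFrm1RootHoldsQDKVOfLe» ↦ «SkelFrmFrom1RootHoldsQDKVOfLePx»):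
# **the second-axis ROOT LEG with the landed rows discharged, UNDER PROXIES** — `PlanarSkeletonFrmFrom.NegB.rootLegAt_frmQ3KV_snd_of_lePx`, the GEN twin of
# «SkelFrmFrom1RootHoldsQDKVOfLe»'s `rootLegAt_frmQ3KV_snd_of_le`, over «SkelFrmFrom1RootHoldsQDKVPx» at the K-2 instance (same record, RAISED kit index `mkP`)

builds on p205010 (kernel theorem, internal audit signed; external expert review pending) — nothing in this file uses p205010; NOTHING is claimed about the
OPEN node U_s `SamePDropOfSkeletonFrmScaled₁` (U is CLOSED, «SkelFrmFrom1HoldsAll», untouched).  Lane `prim-bschramm`, seat `prim-bschramm-p3` gen 27 (design owner;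
(R)-column pen by RULING Us-R3); helper file (`--supports stmt-CriticalPhenomena-4575 --as helper`); NON-VERBATIM GEN row (hunk class 'h1 ↦ proxy package' of
WAVE-Us-MANIFEST §2 + kit class (k2) of design note K-2; FULL census).  HUNKS vs the U twin: (i) `(h1) ↦ {D} (hP : Φ.HasProxies t D)` + floors `hnL`, `hnK : D ≤ n_kit mk`,
`hDk : D ≤ k`, `hnB0 : D ≤ nB0 mkP`; (k2) TWO indices `(mk mkP : ℕ)` with `hRK : KS.RK t O.merged mk + D ≤ KS.RK t O.merged mkP` — the served region / kit pair stays at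
`mk`, EVERY landed row of the U proof (corridor rows, `KS.hrowR`, `KS.exists_landing0s`, `KS.reachR1_le`-type depth rows, `KS.hlen_R*`, `KS.hx_0s`, the bridge `KS.B0`
with `B0_ok_of_atQ3`, `KS.B0_lo_le_hi`, `KS.R'0_le_B0_R'`, `KS.B0_core1_le`, `KS.core1Lo_0_l1`, `KS.hhopB_0`, `KS.hclear₁_0_of_floor`, `KS.hX₁_0`, `ℓB0_ge_of_atQ3`, the slot
floors `hgK`/`hg2`/`hfg`/`hf`/`hexRL`/`hexRB`/`hexYb`/`hexZ`/`hPx`, the hop rows) is READ AT `mkP` verbatim (every one is generic in the kit index; why the index and not a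
bumped record: `KS.B0 … mk …` reads the long width `n_L` and the kit reach `R'0 mk` from ONE record — design note K-2); (iii) zone `Λ t k ↦ Λ (prox t) k` in `hDm`;
(iv) `RL ↦ RL + D` (hop prism / `hexRL` / the kit reach `r₀0 mkP (RL + D)`), bridge radius `Rb := RB0 mkP + D` (`hexRB`; readings `bridge0SetsD_of_atQ3` = the U readings
at radius `RB0 + D`, `Skelφ.bridgeSets_same` being radius-generic), bridge event `hbridge0K_of_atQ3_δr ↦ …Px` («SkelFrmFromBChoiceBridge0Px», floor `hnB0`), and the
seed radius `fatRadius k ↦ D + fatRadius k` in the window row `hρπ` and in the rim-excess device — BOTH DISCHARGED HERE WITHOUT A NEW SLOT FLOOR (`D ≤ k ≤ fatRadius k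
= ψπ`, so `D + fatRadius k + 1 ≤ 2ψπ + 1 ≤ E₀ = Rπ + 1` and `Rex (D + fatRadius k) ≤ Rex (2ψπ)`: haves `hψD`, `hρπD`, `hRexD`).  Conclusion: the U twin's, verbatim.
[cite: KozmaNitzan2024, §4 p. 28 ((32) at the root); §4 Lemma 12 (p. 24); §4 pp. 19–21] [cite: BenjaminiSchramm1996, Conj. 4] [this work]
-/

noncomputable section

open MeasureTheory ProbabilityTheory
open scoped ENNReal Classical

namespace Summit.CriticalPhenomena.PercolationContinuityZ3.Theorems

namespace Transplant

open Literature.Probability.Percolation Literature.Probability.LatticeModels SimpleGraph KNCells KNLevels ChainPlanar ChainPara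
open Literature.Probability.Percolation.KozmaNitzan.Cells (oth sgOf)
open Literature.Barriers.CriticalPhenomena (graphBall graphBall_mono mem_graphBall_self)
open SkelConc (Consts)
open Skel (winGraph)
open SkelI (tanOff)
open Skelφ (rootFrame RootFootT TargetFootT RootFootV TargetFootV pgSideHalfW kgSL kgZ₀ kgZ₁ kgM₁ kgM₂ kgWm₂ kgWp₂ kgZY₀ kgZY₁ kgM₁Y kgM₂Y kgWm₂Y kgWp₂Y kgFarY kgXY)
open ChainPlanar (ScheduleNP BridgePrm BridgeOK)
open Skelφ.StepI (OutNS)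

namespace PlanarSkeletonFrmFrom

namespace NegB

open Neg

variable {κ : Consts} {V : Type} [DecidableEq V] [Countable V] {G : SimpleGraph V} [G.LocallyFinite] {Φ : PlanarSkeletonFrmFrom G} {t : V} {p : unitInterval}
  {hC : Φ.CylSubcritical p} {gv fv : Neg.FSlot} {Pv : PSlot} {ex mx : GSlot} {cv hv : CSlot} {bv : BSlot} {O : OutNS V} {q : unitInterval}

set_option maxHeartbeats 3200000 in
/-- **THE SECOND-AXIS ROOT LEG WITH THE LANDED ROWS DISCHARGED, UNDER PROXIES** — GEN twin of `rootLegAt_frmQ3KV_snd_of_le` («SkelFrmFrom1RootHoldsQDKVOfLe»):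
the residue of «SkelFrmFrom1RootHoldsQDKVPx».rootLegAt_frmQ3KV_sndPx at the K-2 instance `(Dk, mkP) := (O.merged, mkP)` with `hRK : RK mk + D ≤ RK mkP` — the
corridor of record, the bridge of record `KS.B0 … mkP …` (bridge sets at radius `RB0 mkP + D`, event by «SkelFrmFromBChoiceBridge0Px»), the window `Rπ` of the
slot `SUS ex mx`, the landing vertex, the depth and length rows are the LANDED rows read at the raised index `mkP`; what remains are the slot floors at the evaluated
slots (all at `mkP`, radii `+ D`), the width floors `D ≤ n_L, n_kit mk, k, nB0 mkP`, the reading rows and the planar-diameter row, exactly as in the U twin.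
[cite: KozmaNitzan2024, §4 p. 28 ((32) at the root)] -/
theorem rootLegAt_frmQ3KV_snd_of_lePx {κ : Consts} {V : Type} [DecidableEq V] [Countable V] {G : SimpleGraph V} [G.LocallyFinite] {Φ : PlanarSkeletonFrmFrom G} {t : V} {p : unitInterval} {hC : Φ.CylSubcritical p} {gv : Neg.FSlot} {fv : Neg.FSlot} {Pv : PSlot} {ex : GSlot} {mx : GSlot} {cv : CSlot} {hv : CSlot} {bv : BSlot} {O : OutNS V} {q : unitInterval} (hAt : (choiceAtQ3V κ Φ t p Pv gv fv (SUS ex mx) cv hv bv hC).AtQNQ O q) {D : ℕ} (hP : Φ.HasProxies t D)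
    (hp0 : 0 < (p : ℝ)) (hp1 : (p : ℝ) < 1) (mk mkP : ℕ)
    -- UNDER PROXIES: the width floors (C-4) and the RAISED KIT INDEX `mkP` (K-2: same record, `RK mk + D ≤ RK mkP`; the region / kit pair stays at `mk`)
    (hnL : D ≤ nL κ Φ t p O.merged (gOf κ Φ t p O gv) (fOf κ Φ t p O fv)) (hnK : D ≤ KS.nKit O.merged mk) (hDk : D ≤ O.merged.k)
    (hnB0 : D ≤ KS.nB0 κ Φ t p O.merged mkP) (hRK : KS.RK t O.merged mk + D ≤ KS.RK t O.merged mkP)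
    (qxY WxY ZY : ℕ)
    -- slot floors at the evaluated slots
    (hgK : gFloorKG κ Φ t p O.merged mkP ≤ gOf κ Φ t p O gv) (hg2 : 40 * Neg.K κ * KS0.R'0 κ Φ t p O.merged mkP ≤ gOf κ Φ t p O gv)
    (hgR : 60 * (KS.Rs t O.merged mkP + 1) ≤ gOf κ Φ t p O gv) (hfg : 2 * fOf κ Φ t p O fv + 5 * KS0.R'0 κ Φ t p O.merged mkP + 3 ≤ gOf κ Φ t p O gv)
    (hf : KS.fxR0 κ Φ t p O.merged mkP ≤ fOf κ Φ t p O fv)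
    (hexRL : KS0.r₀0 t O.merged mkP (RL κ Φ t p O gv fv + D) + 1 ≤ ex κ Φ t p O.merged (gOf κ Φ t p O gv) (fOf κ Φ t p O fv))
    (hexRB : KS0.r₀0 t O.merged mkP (KS.RB0 κ Φ t p O.merged mkP + D) + 1 ≤ ex κ Φ t p O.merged (gOf κ Φ t p O gv) (fOf κ Φ t p O fv))
    (hexYb : KS.Yb0 κ Φ t p O.merged mkP (gOf κ Φ t p O gv) (fOf κ Φ t p O fv) + 1 ≤ ex κ Φ t p O.merged (gOf κ Φ t p O gv) (fOf κ Φ t p O fv))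
    (hexP : KS.D0s κ Φ t p O.merged mkP (gOf κ Φ t p O gv) (fOf κ Φ t p O fv) (kgq κ Φ t p O.merged (gOf κ Φ t p O gv) (fOf κ Φ t p O fv) 0) + KS.ZDP κ Φ t p O.merged (gOf κ Φ t p O gv) (fOf κ Φ t p O fv) + 1 ≤ ex κ Φ t p O.merged (gOf κ Φ t p O gv) (fOf κ Φ t p O fv))
    (hexY : KS.D2R κ Φ t p O.merged mkP (gOf κ Φ t p O gv) (fOf κ Φ t p O fv) WxY + ZY + 13 * (nL κ Φ t p O.merged (gOf κ Φ t p O gv) (fOf κ Φ t p O fv)) + 1 ≤ ex κ Φ t p O.merged (gOf κ Φ t p O gv) (fOf κ Φ t p O fv))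
    (hPx : (KS.Px0 mkP κ Φ t p O.merged).1 ⊆ (Pv κ Φ t p O.merged).1)
    -- the y′ residual window under the Len3 caps, and the y′ depth numeral `ZY` bounding (C)'s reach at this window
    (hWxY : KS.Rs t O.merged mkP + 34 * (nL κ Φ t p O.merged (gOf κ Φ t p O gv) (fOf κ Φ t p O fv)) + 29 * KS0.R'0 κ Φ t p O.merged mkP + 2 ≤ WxY) (hWx45 : 45 * (nL κ Φ t p O.merged (gOf κ Φ t p O gv) (fOf κ Φ t p O fv)) ≤ WxY)
    (hq3 : 3 * (kgSL (nL κ Φ t p O.merged (gOf κ Φ t p O gv) (fOf κ Φ t p O fv)) (ℓL κ Φ t p O.merged (gOf κ Φ t p O gv) (fOf κ Φ t p O fv)) (hL κ Φ t p O.merged (gOf κ Φ t p O gv) (fOf κ Φ t p O fv))) ≤ (qxY : ℤ)) (hqx20 : (qxY : ℤ) ≤ 20 * (kgSL (nL κ Φ t p O.merged (gOf κ Φ t p O gv) (fOf κ Φ t p O fv)) (ℓL κ Φ t p O.merged (gOf κ Φ t p O gv) (fOf κ Φ t p O fv)) (hL κ Φ t p O.merged (gOf κ Φ t p O gv) (fOf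 κ Φ t p O fv)))) (hxY : KGResY3 κ Φ t p O.merged (gOf κ Φ t p O gv) (fOf κ Φ t p O fv) qxY WxY)
    (h0Y : (kgFarY (nL κ Φ t p O.merged (gOf κ Φ t p O gv) (fOf κ Φ t p O fv)) (ℓL κ Φ t p O.merged (gOf κ Φ t p O gv) (fOf κ Φ t p O fv)) (hL κ Φ t p O.merged (gOf κ Φ t p O gv) (fOf κ Φ t p O fv)) (vL κ Φ t p O.merged (gOf κ Φ t p O gv) (fOf κ Φ t p O fv)) (kgR κ Φ t p O.merged mkP) 0 (kgqY κ Φ t p O.merged (gOf κ Φ t p O gv) (fOf κ Φ t p O fv) qxY) (kgWY κ Φ t p O.merged (gOf κ Φ t p O gv) (fOf κ Φ t p O fv) WxY) 0) ≤ (kgTgtY0 κ Φ t p O.merged (gOf κ Φ t p O gv) (fOf κ Φ t p O fv) mkP))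
    (hXY : (kgXY (nL κ Φ t p O.merged (gOf κ Φ t p O gv) (fOf κ Φ t p O fv)) (ℓL κ Φ t p O.merged (gOf κ Φ t p O gv) (fOf κ Φ t p O fv)) (hL κ Φ t p O.merged (gOf κ Φ t p O gv) (fOf κ Φ t p O fv)) (vL κ Φ t p O.merged (gOf κ Φ t p O gv) (fOf κ Φ t p O fv)) (kgR κ Φ t p O.merged mkP) 0 (kgqY κ Φ t p O.merged (gOf κ Φ t p O gv) (fOf κ Φ t p O fv) qxY) (kgWY κ Φ t p O.merged (gOf κ Φ t p O gv) (fOf κ Φ t p O fv) WxY) (kgNYv0 κ Φ t p O.merged (gOf κ Φ t p O gv) (fOf κ Φ t p O fv) mkP qxY WxY)) ≤ 100 * (kgSL (nL κ Φ t p O.merged (gOf κ Φ t p O gv) (fOf κ Φ t p O fv)) (ℓL κ Φ t p O.merged (gOf κ Φ t p O gv) (fOf κ Φ t p O fv)) (hL κ Φ t p O.merged (gOf κ Φ t p O gv) (fOf κ Φ t p O fv))))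
    (hZY : 13 * ((((((kgNYv0 κ Φ t p O.merged (gOf κ Φ t p O gv) (fOf κ Φ t p O fv) mkP qxY WxY) : ℕ)) : ℤ) + 1) * ((((nL κ Φ t p O.merged (gOf κ Φ t p O gv) (fOf κ Φ t p O fv)) * (ℓL κ Φ t p O.merged (gOf κ Φ t p O gv) (fOf κ Φ t p O fv)) / Skelφ.shearUnit (nL κ Φ t p O.merged (gOf κ Φ t p O gv) (fOf κ Φ t p O fv)) (hL κ Φ t p O.merged (gOf κ Φ t p O gv) (fOf κ Φ t p O fv)) + 1 : ℕ)) : ℤ) + (kgZY₀ (nL κ Φ t p O.merged (gOf κ Φ t p O gv) (fOf κ Φ t p O fv)) (vL κ Φ t p O.merged (gOf κ Φ t p O gv) (fOf κ Φ t p O fv)) (kgR κ Φ t p O.merged mkP) 0 (kgWY κ Φ t p O.merged (gOf κ Φ t p O gv) (fOf κ Φ t p O fv) WxY) (kgNYv0 κ Φ t p O.merged (gOf κ Φ t p O gv) (fOf κ Φ t p O fv) mkP qxY WxY) (kgM₁Y (nL κ Φ t p O.merged (gOf κ Φ t p O gv) (fOf κ Φ t p O fv)) (vL κ Φ t p O.merged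 (gOf κ Φ t p O gv) (fOf κ Φ t p O fv)) (kgR κ Φ t p O.merged mkP) 0 (kgWY κ Φ t p O.merged (gOf κ Φ t p O gv) (fOf κ Φ t p O fv) WxY) (kgNYv0 κ Φ t p O.merged (gOf κ Φ t p O gv) (fOf κ Φ t p O fv) mkP qxY WxY)) (kgWm₂Y (nL κ Φ t p O.merged (gOf κ Φ t p O gv) (fOf κ Φ t p O fv)) (vL κ Φ t p O.merged (gOf κ Φ t p O gv) (fOf κ Φ t p O fv)) (kgR κ Φ t p O.merged mkP) 0 (kgWY κ Φ t p O.merged (gOf κ Φ t p O gv) (fOf κ Φ t p O fv) WxY) (kgNYv0 κ Φ t p O.merged (gOf κ Φ t p O gv) (fOf κ Φ t p O fv) mkP qxY WxY)) (kgWp₂Y (nL κ Φ t p O.merged (gOf κ Φ t p O gv) (fOf κ Φ t p O fv)) (vL κ Φ t p O.merged (gOf κ Φ t p O gv) (fOf κ Φ t p O fv)) (kgR κ Φ t p O.merged mkP) 0 (kgWY κ Φ t p O.merged (gOf κ Φ t p O gv) (fOf κ Φ t p O fv) WxY) (kgNYv0 κ Φ t p O.merged (gOf κ Φ t p O gv)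 (fOf κ Φ t p O fv) mkP qxY WxY)) (kgM₂Y (nL κ Φ t p O.merged (gOf κ Φ t p O gv) (fOf κ Φ t p O fv)) (ℓL κ Φ t p O.merged (gOf κ Φ t p O gv) (fOf κ Φ t p O fv)) (hL κ Φ t p O.merged (gOf κ Φ t p O gv) (fOf κ Φ t p O fv)) (vL κ Φ t p O.merged (gOf κ Φ t p O gv) (fOf κ Φ t p O fv)) (kgR κ Φ t p O.merged mkP) 0 (kgqY κ Φ t p O.merged (gOf κ Φ t p O gv) (fOf κ Φ t p O fv) qxY) (kgWY κ Φ t p O.merged (gOf κ Φ t p O gv) (fOf κ Φ t p O fv) WxY) (kgNYv0 κ Φ t p O.merged (gOf κ Φ t p O gv) (fOf κ Φ t p O fv) mkP qxY WxY))) + (kgZY₁ (nL κ Φ t p O.merged (gOf κ Φ t p O gv) (fOf κ Φ t p O fv)) (ℓL κ Φ t p O.merged (gOf κ Φ t p O gv) (fOf κ Φ t p O fv)) (hL κ Φ t p O.merged (gOf κ Φ t p O gv) (fOf κ Φ t p O fv)) (kgR κ Φ t p O.merged mkP) 0 (kgqY κ Φ t p O.merged (gOf κ Φ t p O gv) (fOf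 κ Φ t p O fv) qxY) (kgNYv0 κ Φ t p O.merged (gOf κ Φ t p O gv) (fOf κ Φ t p O fv) mkP qxY WxY) (kgM₁Y (nL κ Φ t p O.merged (gOf κ Φ t p O gv) (fOf κ Φ t p O fv)) (vL κ Φ t p O.merged (gOf κ Φ t p O gv) (fOf κ Φ t p O fv)) (kgR κ Φ t p O.merged mkP) 0 (kgWY κ Φ t p O.merged (gOf κ Φ t p O gv) (fOf κ Φ t p O fv) WxY) (kgNYv0 κ Φ t p O.merged (gOf κ Φ t p O gv) (fOf κ Φ t p O fv) mkP qxY WxY)) (kgM₂Y (nL κ Φ t p O.merged (gOf κ Φ t p O gv) (fOf κ Φ t p O fv)) (ℓL κ Φ t p O.merged (gOf κ Φ t p O gv) (fOf κ Φ t p O fv)) (hL κ Φ t p O.merged (gOf κ Φ t p O gv) (fOf κ Φ t p O fv)) (vL κ Φ t p O.merged (gOf κ Φ t p O gv) (fOf κ Φ t p O fv)) (kgR κ Φ t p O.merged mkP) 0 (kgqY κ Φ t p O.merged (gOf κ Φ t p O gv) (fOf κ Φ t p O fv) qxY) (kgWY κ Φ t p O.merged (gOf κ Φ t p O gv) (fOf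 κ Φ t p O fv) WxY) (kgNYv0 κ Φ t p O.merged (gOf κ Φ t p O gv) (fOf κ Φ t p O fv) mkP qxY WxY)))) ≤ (ZY : ℤ))
    -- the cells' radii against the seed
    (hRs5 : ∀ i, KS.Rs t O.merged mkP + 1 ≤ 5 * ((fcellsA κ Φ t p O.merged (gOf κ Φ t p O gv) (fOf κ Φ t p O fv))).r i)
    -- the five READING rows of the root's boxes (second axis): bridge region, prefix regions, y′-corridor regions, y′ last core, planar diameter
    (hfoot₁ : ∀ w ∈ graphBall G t (Rπ κ Φ t p O.merged (gOf κ Φ t p O gv) (fOf κ Φ t p O fv) (SUS ex mx) q), rootFrame (φL κ Φ t p O.D O.DT.toDataN O.ori (gOf κ Φ t p O gv) (fOf κ Φ t p O fv)) t 1 w ∈ Finset.Icc (KS.B0 κ Φ t p O.merged mkP (gOf κ Φ t p O gv) (fOf κ Φ t p O fv)).regionLo (KS.B0 κ Φ t p O.merged mkP (gOf κ Φ t p O gv) (fOf κ Φ t p O fv)).regionHi →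
      RootFootV (fcellsV κ Φ t p O.merged (gOf κ Φ t p O gv) (fOf κ Φ t p O fv) (cOf κ Φ t p O gv fv cv) (hOf κ Φ t p O gv fv hv)) (((1 : Fin 2), true) : MDir) ((fineOA κ Φ t p O.D O.DT.toDataN O.ori (gOf κ Φ t p O gv) (fOf κ Φ t p O fv)) w))
    (hfoot₂ : ∀ c₁ : V, (φL κ Φ t p O.D O.DT.toDataN O.ori (gOf κ Φ t p O gv) (fOf κ Φ t p O fv)) c₁ 0 - (φL κ Φ t p O.D O.DT.toDataN O.ori (gOf κ Φ t p O gv) (fOf κ Φ t p O fv)) t 0 = (KS.X1 κ Φ t p O.merged mkP (gOf κ Φ t p O gv) (fOf κ Φ t p O fv) (kgq κ Φ t p O.merged (gOf κ Φ t p O gv) (fOf κ Φ t p O fv) 0)) → (φL κ Φ t p O.D O.DT.toDataN O.ori (gOf κ Φ t p O gv) (fOf κ Φ t p O fv)) c₁ 1 - (φL κ Φ t p O.D O.DT.toDataN O.ori (gOf κ Φ t p O gv) (fOf κ Φ t p O fv)) t 1 = (KS.Y1s κ Φ t p O.merged mkP (gOf κ Φ t p O gv) (fOf κ Φ t p O fv)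 (kgq κ Φ t p O.merged (gOf κ Φ t p O gv) (fOf κ Φ t p O fv) 0)) →
      ∀ k ≤ (Skelφ.kgCorrSched ((kgRows0_of κ Φ t p O.merged (gOf κ Φ t p O gv) (fOf κ Φ t p O fv) mkP 0 0 (eqNumL_of_atQ (atQ3_of_atQ3V hAt)) hgK).kgVals_ok₁ 30) ((kgRows0_of κ Φ t p O.merged (gOf κ Φ t p O gv) (fOf κ Φ t p O fv) mkP 0 0 (eqNumL_of_atQ (atQ3_of_atQ3V hAt)) hgK).kgVals_ok₂ 30) ((kgRows0_of κ Φ t p O.merged (gOf κ Φ t p O gv) (fOf κ Φ t p O fv) mkP 0 0 (eqNumL_of_atQ (atQ3_of_atQ3V hAt)) hgK).kgVals_split 30)).N, ∀ w ∈ graphBall G t (Rπ κ Φ t p O.merged (gOf κ Φ t p O gv) (fOf κ Φ t p O fv) (SUS ex mx) q), Skelφ.runX (φL κ Φ t p O.D O.DT.toDataN O.ori (gOf κ Φ t p O gv) (fOf κ Φ t p O fv)) c₁ (nL κ Φ t p O.merged (gOf κ Φ t p O gv) (fOf κ Φ t p O fv)) (hL κ Φ t p O.merged (gOf κ Φ t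 p O gv) (fOf κ Φ t p O fv)) 1 w ∈ (Skelφ.kgCorrSched ((kgRows0_of κ Φ t p O.merged (gOf κ Φ t p O gv) (fOf κ Φ t p O fv) mkP 0 0 (eqNumL_of_atQ (atQ3_of_atQ3V hAt)) hgK).kgVals_ok₁ 30) ((kgRows0_of κ Φ t p O.merged (gOf κ Φ t p O gv) (fOf κ Φ t p O fv) mkP 0 0 (eqNumL_of_atQ (atQ3_of_atQ3V hAt)) hgK).kgVals_ok₂ 30) ((kgRows0_of κ Φ t p O.merged (gOf κ Φ t p O gv) (fOf κ Φ t p O fv) mkP 0 0 (eqNumL_of_atQ (atQ3_of_atQ3V hAt)) hgK).kgVals_split 30)).region k →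
        RootFootV (fcellsV κ Φ t p O.merged (gOf κ Φ t p O gv) (fOf κ Φ t p O fv) (cOf κ Φ t p O gv fv cv) (hOf κ Φ t p O gv fv hv)) (((1 : Fin 2), true) : MDir) ((fineOA κ Φ t p O.D O.DT.toDataN O.ori (gOf κ Φ t p O gv) (fOf κ Φ t p O fv)) w))
    (hfoot₃ : ∀ c₂ : V, (φL κ Φ t p O.D O.DT.toDataN O.ori (gOf κ Φ t p O gv) (fOf κ Φ t p O fv)) c₂ 0 - (φL κ Φ t p O.D O.DT.toDataN O.ori (gOf κ Φ t p O gv) (fOf κ Φ t p O fv)) t 0 = (((KS.X2R κ Φ t p O.merged mkP (gOf κ Φ t p O gv) (fOf κ Φ t p O fv) WxY) : ℕ) : ℤ) → (φL κ Φ t p O.D O.DT.toDataN O.ori (gOf κ Φ t p O gv) (fOf κ Φ t p O fv)) c₂ 1 - (φL κ Φ t p O.D O.DT.toDataN O.ori (gOf κ Φ t p O gv) (fOf κ Φ t p O fv)) t 1 = (KS.Y2R κ Φ t p O.merged mkP (gOf κ Φ t p O gv) (fOf κ Φ t p O fv) WxY) →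
      ∀ k ≤ (Skelφ.kgCorrSchedY (kgYRows0_of κ Φ t p O.merged (gOf κ Φ t p O gv) (fOf κ Φ t p O fv) mkP qxY (KS.WxYR κ Φ t p O.merged mkP (gOf κ Φ t p O gv) (fOf κ Φ t p O fv) WxY) (eqNumL_of_atQ (atQ3_of_atQ3V hAt)) hgK).hn (kgYRows0_of κ Φ t p O.merged (gOf κ Φ t p O gv) (fOf κ Φ t p O fv) mkP qxY (KS.WxYR κ Φ t p O.merged mkP (gOf κ Φ t p O gv) (fOf κ Φ t p O fv) WxY) (eqNumL_of_atQ (atQ3_of_atQ3V hAt)) hgK).hv (kgYRows0_of κ Φ t p O.merged (gOf κ Φ t p O gv) (fOf κ Φ t p O fv) mkP qxY (KS.WxYR κ Φ t p O.merged mkP (gOf κ Φ t p O gv) (fOf κ Φ t p O fv) WxY) (eqNumL_of_atQ (atQ3_of_atQ3V hAt)) hgK).hlay ((kgYRows0_of κ Φ t p O.merged (gOf κ Φ t p O gv) (fOf κ Φ t p O fv) mkP qxY (KS.WxYR κ Φ t p O.merged mkP (gOf κ Φ t p O gv) (fOf κ Φ t p O fv) WxY) (eqNumL_of_atQ (atQ3_of_atQ3V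 hAt)) hgK).kgYVals_ok₁ (kgNYv0 κ Φ t p O.merged (gOf κ Φ t p O gv) (fOf κ Φ t p O fv) mkP qxY WxY)) ((kgYRows0_of κ Φ t p O.merged (gOf κ Φ t p O gv) (fOf κ Φ t p O fv) mkP qxY (KS.WxYR κ Φ t p O.merged mkP (gOf κ Φ t p O gv) (fOf κ Φ t p O fv) WxY) (eqNumL_of_atQ (atQ3_of_atQ3V hAt)) hgK).kgYVals_ok₂ (kgNYv0 κ Φ t p O.merged (gOf κ Φ t p O gv) (fOf κ Φ t p O fv) mkP qxY WxY)) ((kgYRows0_of κ Φ t p O.merged (gOf κ Φ t p O gv) (fOf κ Φ t p O fv) mkP qxY (KS.WxYR κ Φ t p O.merged mkP (gOf κ Φ t p O gv) (fOf κ Φ t p O fv) WxY) (eqNumL_of_atQ (atQ3_of_atQ3V hAt)) hgK).kgYVals_split (kgNYv0 κ Φ t p O.merged (gOf κ Φ t p O gv) (fOf κ Φ t p O fv) mkP qxY WxY))).N, ∀ w ∈ graphBall G t (Rπ κ Φ t p O.merged (gOf κ Φ t p O gv) (fOf κ Φ t p O fv) (SUS ex mx) q), Skelφ.runX (φL κ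 Φ t p O.D O.DT.toDataN O.ori (gOf κ Φ t p O gv) (fOf κ Φ t p O fv)) c₂ (nL κ Φ t p O.merged (gOf κ Φ t p O gv) (fOf κ Φ t p O fv)) (hL κ Φ t p O.merged (gOf κ Φ t p O gv) (fOf κ Φ t p O fv)) 1 w ∈ (Skelφ.kgCorrSchedY (kgYRows0_of κ Φ t p O.merged (gOf κ Φ t p O gv) (fOf κ Φ t p O fv) mkP qxY (KS.WxYR κ Φ t p O.merged mkP (gOf κ Φ t p O gv) (fOf κ Φ t p O fv) WxY) (eqNumL_of_atQ (atQ3_of_atQ3V hAt)) hgK).hn (kgYRows0_of κ Φ t p O.merged (gOf κ Φ t p O gv) (fOf κ Φ t p O fv) mkP qxY (KS.WxYR κ Φ t p O.merged mkP (gOf κ Φ t p O gv) (fOf κ Φ t p O fv) WxY) (eqNumL_of_atQ (atQ3_of_atQ3V hAt)) hgK).hv (kgYRows0_of κ Φ t p O.merged (gOf κ Φ t p O gv) (fOf κ Φ t p O fv) mkP qxY (KS.WxYR κ Φ t p O.merged mkP (gOf κ Φ t p O gv) (fOf κ Φ t p O fv) WxY) (eqNumL_of_atQ (atQ3_of_atQ3V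 hAt)) hgK).hlay ((kgYRows0_of κ Φ t p O.merged (gOf κ Φ t p O gv) (fOf κ Φ t p O fv) mkP qxY (KS.WxYR κ Φ t p O.merged mkP (gOf κ Φ t p O gv) (fOf κ Φ t p O fv) WxY) (eqNumL_of_atQ (atQ3_of_atQ3V hAt)) hgK).kgYVals_ok₁ (kgNYv0 κ Φ t p O.merged (gOf κ Φ t p O gv) (fOf κ Φ t p O fv) mkP qxY WxY)) ((kgYRows0_of κ Φ t p O.merged (gOf κ Φ t p O gv) (fOf κ Φ t p O fv) mkP qxY (KS.WxYR κ Φ t p O.merged mkP (gOf κ Φ t p O gv) (fOf κ Φ t p O fv) WxY) (eqNumL_of_atQ (atQ3_of_atQ3V hAt)) hgK).kgYVals_ok₂ (kgNYv0 κ Φ t p O.merged (gOf κ Φ t p O gv) (fOf κ Φ t p O fv) mkP qxY WxY)) ((kgYRows0_of κ Φ t p O.merged (gOf κ Φ t p O gv) (fOf κ Φ t p O fv) mkP qxY (KS.WxYR κ Φ t p O.merged mkP (gOf κ Φ t p O gv) (fOf κ Φ t p O fv) WxY) (eqNumL_of_atQ (atQ3_of_atQ3V hAt)) hgK).kgYVals_split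 (kgNYv0 κ Φ t p O.merged (gOf κ Φ t p O gv) (fOf κ Φ t p O fv) mkP qxY WxY))).region k →
        RootFootV (fcellsV κ Φ t p O.merged (gOf κ Φ t p O gv) (fOf κ Φ t p O fv) (cOf κ Φ t p O gv fv cv) (hOf κ Φ t p O gv fv hv)) (((1 : Fin 2), true) : MDir) ((fineOA κ Φ t p O.D O.DT.toDataN O.ori (gOf κ Φ t p O gv) (fOf κ Φ t p O fv)) w))
    (hlastf : ∀ c₂ : V, (φL κ Φ t p O.D O.DT.toDataN O.ori (gOf κ Φ t p O gv) (fOf κ Φ t p O fv)) c₂ 0 - (φL κ Φ t p O.D O.DT.toDataN O.ori (gOf κ Φ t p O gv) (fOf κ Φ t p O fv)) t 0 = (((KS.X2R κ Φ t p O.merged mkP (gOf κ Φ t p O gv) (fOf κ Φ t p O fv) WxY) : ℕ) : ℤ) → (φL κ Φ t p O.D O.DT.toDataN O.ori (gOf κ Φ t p O gv) (fOf κ Φ t p O fv)) c₂ 1 - (φL κ Φ t p O.D O.DT.toDataN O.ori (gOf κ Φ t p O gv) (fOf κ Φ t p O fv)) t 1 = (KS.Y2R κ Φ t p O.merged mkP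 (gOf κ Φ t p O gv) (fOf κ Φ t p O fv) WxY) →
      ∀ w ∈ graphBall G t (Rπ κ Φ t p O.merged (gOf κ Φ t p O gv) (fOf κ Φ t p O fv) (SUS ex mx) q), Skelφ.runX (φL κ Φ t p O.D O.DT.toDataN O.ori (gOf κ Φ t p O gv) (fOf κ Φ t p O fv)) c₂ (nL κ Φ t p O.merged (gOf κ Φ t p O gv) (fOf κ Φ t p O fv)) (hL κ Φ t p O.merged (gOf κ Φ t p O gv) (fOf κ Φ t p O fv)) 1 w ∈ ScheduleNP.core (Skelφ.kgCorrSchedY (kgYRows0_of κ Φ t p O.merged (gOf κ Φ t p O gv) (fOf κ Φ t p O fv) mkP qxY (KS.WxYR κ Φ t p O.merged mkP (gOf κ Φ t p O gv) (fOf κ Φ t p O fv) WxY) (eqNumL_of_atQ (atQ3_of_atQ3V hAt)) hgK).hn (kgYRows0_of κ Φ t p O.merged (gOf κ Φ t p O gv) (fOf κ Φ t p O fv) mkP qxY (KS.WxYR κ Φ t p O.merged mkP (gOf κ Φ t p O gv) (fOf κ Φ t p O fv) WxY) (eqNumL_of_atQ (atQ3_of_atQ3V hAt)) hgK).hv (kgYRows0_of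 κ Φ t p O.merged (gOf κ Φ t p O gv) (fOf κ Φ t p O fv) mkP qxY (KS.WxYR κ Φ t p O.merged mkP (gOf κ Φ t p O gv) (fOf κ Φ t p O fv) WxY) (eqNumL_of_atQ (atQ3_of_atQ3V hAt)) hgK).hlay ((kgYRows0_of κ Φ t p O.merged (gOf κ Φ t p O gv) (fOf κ Φ t p O fv) mkP qxY (KS.WxYR κ Φ t p O.merged mkP (gOf κ Φ t p O gv) (fOf κ Φ t p O fv) WxY) (eqNumL_of_atQ (atQ3_of_atQ3V hAt)) hgK).kgYVals_ok₁ (kgNYv0 κ Φ t p O.merged (gOf κ Φ t p O gv) (fOf κ Φ t p O fv) mkP qxY WxY)) ((kgYRows0_of κ Φ t p O.merged (gOf κ Φ t p O gv) (fOf κ Φ t p O fv) mkP qxY (KS.WxYR κ Φ t p O.merged mkP (gOf κ Φ t p O gv) (fOf κ Φ t p O fv) WxY) (eqNumL_of_atQ (atQ3_of_atQ3V hAt)) hgK).kgYVals_ok₂ (kgNYv0 κ Φ t p O.merged (gOf κ Φ t p O gv) (fOf κ Φ t p O fv) mkP qxY WxY)) ((kgYRows0_of κ Φ t p O.merged (gOf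 κ Φ t p O gv) (fOf κ Φ t p O fv) mkP qxY (KS.WxYR κ Φ t p O.merged mkP (gOf κ Φ t p O gv) (fOf κ Φ t p O fv) WxY) (eqNumL_of_atQ (atQ3_of_atQ3V hAt)) hgK).kgYVals_split (kgNYv0 κ Φ t p O.merged (gOf κ Φ t p O gv) (fOf κ Φ t p O fv) mkP qxY WxY))) ((Skelφ.kgCorrSchedY (kgYRows0_of κ Φ t p O.merged (gOf κ Φ t p O gv) (fOf κ Φ t p O fv) mkP qxY (KS.WxYR κ Φ t p O.merged mkP (gOf κ Φ t p O gv) (fOf κ Φ t p O fv) WxY) (eqNumL_of_atQ (atQ3_of_atQ3V hAt)) hgK).hn (kgYRows0_of κ Φ t p O.merged (gOf κ Φ t p O gv) (fOf κ Φ t p O fv) mkP qxY (KS.WxYR κ Φ t p O.merged mkP (gOf κ Φ t p O gv) (fOf κ Φ t p O fv) WxY) (eqNumL_of_atQ (atQ3_of_atQ3V hAt)) hgK).hv (kgYRows0_of κ Φ t p O.merged (gOf κ Φ t p O gv) (fOf κ Φ t p O fv) mkP qxY (KS.WxYR κ Φ t p O.merged mkP (gOf κ Φ t p O gv) (fOf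 κ Φ t p O fv) WxY) (eqNumL_of_atQ (atQ3_of_atQ3V hAt)) hgK).hlay ((kgYRows0_of κ Φ t p O.merged (gOf κ Φ t p O gv) (fOf κ Φ t p O fv) mkP qxY (KS.WxYR κ Φ t p O.merged mkP (gOf κ Φ t p O gv) (fOf κ Φ t p O fv) WxY) (eqNumL_of_atQ (atQ3_of_atQ3V hAt)) hgK).kgYVals_ok₁ (kgNYv0 κ Φ t p O.merged (gOf κ Φ t p O gv) (fOf κ Φ t p O fv) mkP qxY WxY)) ((kgYRows0_of κ Φ t p O.merged (gOf κ Φ t p O gv) (fOf κ Φ t p O fv) mkP qxY (KS.WxYR κ Φ t p O.merged mkP (gOf κ Φ t p O gv) (fOf κ Φ t p O fv) WxY) (eqNumL_of_atQ (atQ3_of_atQ3V hAt)) hgK).kgYVals_ok₂ (kgNYv0 κ Φ t p O.merged (gOf κ Φ t p O gv) (fOf κ Φ t p O fv) mkP qxY WxY)) ((kgYRows0_of κ Φ t p O.merged (gOf κ Φ t p O gv) (fOf κ Φ t p O fv) mkP qxY (KS.WxYR κ Φ t p O.merged mkP (gOf κ Φ t p O gv) (fOf κ Φ t p O fv) WxY)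 (eqNumL_of_atQ (atQ3_of_atQ3V hAt)) hgK).kgYVals_split (kgNYv0 κ Φ t p O.merged (gOf κ Φ t p O gv) (fOf κ Φ t p O fv) mkP qxY WxY))).N + 1) →
        TargetFootV (fcellsV κ Φ t p O.merged (gOf κ Φ t p O gv) (fOf κ Φ t p O fv) (cOf κ Φ t p O gv fv cv) (hOf κ Φ t p O gv fv hv)) (bOf κ Φ t p O gv fv bv) (((1 : Fin 2), true) : MDir) ((fineOA κ Φ t p O.D O.DT.toDataN O.ori (gOf κ Φ t p O gv) (fOf κ Φ t p O fv)) w))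
    (hDm : ∀ d ∈ ((((KSchA.mk (ΓQV κ Φ t p O gv fv (SUS ex mx) cv hv bv q) q κ.δ : KSchA V ℕ)).U0root (((1 : Fin 2), true) : MDir)).filter fun y => y ∈ graphBall G t (Rπ κ Φ t p O.merged (gOf κ Φ t p O gv) (fOf κ Φ t p O fv) (SUS ex mx) q)) \ O.merged.Λ (hP.prox t) O.merged.k,
      ∀ d' ∈ ((((KSchA.mk (ΓQV κ Φ t p O gv fv (SUS ex mx) cv hv bv q) q κ.δ : KSchA V ℕ)).U0root (((1 : Fin 2), true) : MDir)).filter fun y => y ∈ graphBall G t (Rπ κ Φ t p O.merged (gOf κ Φ t p O gv) (fOf κ Φ t p O fv) (SUS ex mx) q)) \ O.merged.Λ (hP.prox t) O.merged.k,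
        (φL κ Φ t p O.D O.DT.toDataN O.ori (gOf κ Φ t p O gv) (fOf κ Φ t p O fv)) d - (φL κ Φ t p O.D O.DT.toDataN O.ori (gOf κ Φ t p O gv) (fOf κ Φ t p O fv)) d' ∈ box 2 (mRS κ Φ t p O.merged (gOf κ Φ t p O gv) (fOf κ Φ t p O fv) (mx κ Φ t p O.merged (gOf κ Φ t p O gv) (fOf κ Φ t p O fv)))) :
    ∃ n, n ≤ LfQ κ.K₀ ∧ ∃ (c : V) (Rπ : ℕ) (W : Sym2 V → unitInterval) (s : Fin (n + 1) → KNLevels.TStep (winGraph G c Rπ))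
      (T' : Fin (n + 1) → Finset V) (η' : ℝ),
      (∀ T : Finset V, (prodBernoulli W).real (⋃ t' ∈ T, openConn (ΓQV κ Φ t p O gv fv (SUS ex mx) cv hv bv q).root t') ≤
        (prodBernoulli (pinW (KNLevels.lattW G q) ↑((⟨ΓQV κ Φ t p O gv fv (SUS ex mx) cv hv bv q, q, κ.δ⟩ : KSchA V ℕ).U₀ G)
          ↑((⟨ΓQV κ Φ t p O gv fv (SUS ex mx) cv hv bv q, q, κ.δ⟩ : KSchA V ℕ).U₀ G))).real
          (⋃ t' ∈ (↑T : Set V), openConnIn (↑((ΓQV κ Φ t p O gv fv (SUS ex mx) cv hv bv q).Q (ΓQV κ Φ t p O gv fv (SUS ex mx) cv hv bv q).a₀ 0 ∪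
            (ΓQV κ Φ t p O gv fv (SUS ex mx) cv hv bv q).Ewv (ΓQV κ Φ t p O gv fv (SUS ex mx) cv hv bv q).a₀ 0 (((1 : Fin 2), true) : MDir)) : Set V)
            (ΓQV κ Φ t p O gv fv (SUS ex mx) cv hv bv q).root t')) ∧
      (∀ i : Fin (n + 1), (s i).L.o = (ΓQV κ Φ t p O gv fv (SUS ex mx) cv hv bv q).root) ∧
      (∀ i : Fin n, T' (Fin.castSucc i) ⊆ (s i.succ).L.X 0) ∧ (∀ i : Fin (n + 1), T' i ⊆ (s i).T) ∧
      (∀ i : Fin (n + 1), (s i).KitsAtF W q Φ.Δ (κ.δr 0)) ∧ η' ≤ κ.δr 0 / 2 ∧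
      (∀ i : Fin (n + 1), (prodBernoulli W).real (⋃ t' ∈ (s i).T \ T' i, openConn (ΓQV κ Φ t p O gv fv (SUS ex mx) cv hv bv q).root t') ≤ η') ∧
      1 - κ.δr 0 < (prodBernoulli W).real (s 0).L.reachB ∧
      T' (Fin.last n) ⊆ (ΓQV κ Φ t p O gv fv (SUS ex mx) cv hv bv q).M (ΓQV κ Φ t p O gv fv (SUS ex mx) cv hv bv q).a₀ ((0 : Site 2) + stepVec (((1 : Fin 2), true) : MDir)) := by
  have hAt' := atQ3_of_atQ3V hAt
  -- UNDER PROXIES the seed radius is `D + fatRadius k ≤ 2·ψπ` (`D ≤ k ≤ fatRadius k = ψπ`): the window and the rim-excess device still have room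
  have hψD : D + Skelφ.fatRadius Φ.frame hC O.merged.k ≤ 2 * ψπ Φ p O.merged := by
    rw [ψπ_eq Φ hC O.merged]; have := Skelφ.le_fatRadius Φ.frame hC O.merged.k; omega
  have hρπD : D + Skelφ.fatRadius Φ.frame hC O.merged.k ≤ Rπ κ Φ t p O.merged (gOf κ Φ t p O gv) (fOf κ Φ t p O fv) (SUS ex mx) q := by
    refine le_Rπ_of κ Φ t p O.merged (gOf κ Φ t p O gv) (fOf κ Φ t p O fv) (SUS ex mx) q ?_
    rw [E₀_SUS_eq]; omega
  have hRexD : ∀ {r₀ : ℕ}, r₀ + 1 ≤ ex κ Φ t p O.merged (gOf κ Φ t p O gv) (fOf κ Φ t p O fv) →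
      (SUS ex mx κ Φ t p O.merged (gOf κ Φ t p O gv) (fOf κ Φ t p O fv) q).Rex (D + Skelφ.fatRadius Φ.frame hC O.merged.k) ≤
        Rπ κ Φ t p O.merged (gOf κ Φ t p O gv) (fOf κ Φ t p O fv) (SUS ex mx) q - r₀ := by
    intro r₀ h
    have h1 : Rex κ Φ (mRS κ Φ t p O.merged (gOf κ Φ t p O gv) (fOf κ Φ t p O fv) (mx κ Φ t p O.merged (gOf κ Φ t p O gv) (fOf κ Φ t p O fv))) q
        (D + Skelφ.fatRadius Φ.frame hC O.merged.k) ≤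
        Rex κ Φ (mRS κ Φ t p O.merged (gOf κ Φ t p O gv) (fOf κ Φ t p O fv) (mx κ Φ t p O.merged (gOf κ Φ t p O gv) (fOf κ Φ t p O fv))) q (2 * ψπ Φ p O.merged) :=
      Rex_mono κ Φ _ q hψD
    have h2 := Rπ_succ κ Φ t p O.merged (gOf κ Φ t p O gv) (fOf κ Φ t p O fv) (SUS ex mx) q
    rw [E₀_SUS_eq] at h2
    show Rex κ Φ _ q _ ≤ _
    omega
  -- facts at `AtQNQ`
  have hN : EqNumL κ Φ t p O.merged (gOf κ Φ t p O gv) (fOf κ Φ t p O fv) := eqNumL_of_atQ hAt'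
  obtain ⟨hn1, -⟩ := one_le_of_eqNumL κ Φ t p O.merged (gOf κ Φ t p O gv) (fOf κ Φ t p O fv) hN
  obtain ⟨-, -, -, hCq⟩ := factsNS_of_atQ hAt'
  have hkit : Neg.δkit κ Φ ≤ κ.δr 0 := Neg.δkit_le_δr κ Φ (n := 0) (by norm_num)
  have hη : Neg.η κ Φ ≤ κ.δr 0 / 2 := by
    unfold Neg.η; exact div_le_div_of_nonneg_right hkit (by norm_num)
  have hstepφ := steps_φL κ Φ t p O.D O.DT.toDataN O.ori (gOf κ Φ t p O gv) (fOf κ Φ t p O fv)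
  obtain ⟨-, -, hs958, -, -, -, -⟩ := KS.rootRun_floors κ Φ t p O.merged mkP (gOf κ Φ t p O gv) (fOf κ Φ t p O fv) hN hgK hg2
  have hsL0 : (0 : ℤ) ≤ (kgSL (nL κ Φ t p O.merged (gOf κ Φ t p O gv) (fOf κ Φ t p O fv)) (ℓL κ Φ t p O.merged (gOf κ Φ t p O gv) (fOf κ Φ t p O fv)) (hL κ Φ t p O.merged (gOf κ Φ t p O gv) (fOf κ Φ t p O fv))) := by linarith
  obtain ⟨hnR, hrow⟩ := KS.hrowP κ Φ t p O.merged mkP (gOf κ Φ t p O gv) (fOf κ Φ t p O fv) hN hgK hg2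
  -- the two landing vertices on the terminal's shear line ((R-47)(a), (R-46)(a))
  obtain ⟨c₁, hc₁, hX1, hY1⟩ := KS.exists_landing0s κ Φ t p O.merged mkP (gOf κ Φ t p O gv) (fOf κ Φ t p O fv) (kgq κ Φ t p O.merged (gOf κ Φ t p O gv) (fOf κ Φ t p O fv) 0) hstepφ
  obtain ⟨c₂, hc₂, hX2, hY2⟩ := KS.exists_landing2 κ Φ t p O.merged mkP (gOf κ Φ t p O gv) (fOf κ Φ t p O fv) WxY hstepφ
  -- the bridge of record
  have hℓB27 := ℓB0_ge_of_atQ3 hAt' mkP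
  have hℓB3 : 3 ≤ KS.ℓB0 κ Φ t p O.merged mkP := by omega
  obtain ⟨hQb, hFb⟩ := bridge0SetsD_of_atQ3 hAt' mkP D
  have hbridge := hbridge0K_of_atQ3_δrPx hAt' hP mkP hPx hnB0
  -- the ex-floors read into the window radius `Rπ`
  have hr₀R := ex_le_Rπ κ Φ t p O.merged (gOf κ Φ t p O gv) (fOf κ Φ t p O fv) ex mx q hexRL
  have hr₀bR := ex_le_Rπ κ Φ t p O.merged (gOf κ Φ t p O gv) (fOf κ Φ t p O fv) ex mx q hexRB
  have hYbπ := ex_le_Rπ κ Φ t p O.merged (gOf κ Φ t p O gv) (fOf κ Φ t p O fv) ex mx q hexYb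
  have hPπ := ex_le_Rπ κ Φ t p O.merged (gOf κ Φ t p O gv) (fOf κ Φ t p O fv) ex mx q hexP
  have hYπ := ex_le_Rπ κ Φ t p O.merged (gOf κ Φ t p O gv) (fOf κ Φ t p O fv) ex mx q hexY
  have hc1R : ((KS.B0 κ Φ t p O.merged mkP (gOf κ Φ t p O gv) (fOf κ Φ t p O fv)).core1Lo 0).natAbs + ((KS.B0 κ Φ t p O.merged mkP (gOf κ Φ t p O gv) (fOf κ Φ t p O fv)).core1Lo 1).natAbs ≤ (Rπ κ Φ t p O.merged (gOf κ Φ t p O gv) (fOf κ Φ t p O fv) (SUS ex mx) q) :=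
    (KS.core1Lo_0_l1 κ Φ t p O.merged mkP (gOf κ Φ t p O gv) (fOf κ Φ t p O fv)).trans hYbπ
  -- the cross-link budget of the PREFIX `prB0 + ℓB0 + 5R'0 + 2 ≤ kgW 0 = ⌊sL⌋` ((R-47)(b) amended: `sL ≥ M_L − 1 ≥ g − 1 ≥ 2f + 5R'0 + 2`)
  have hprB := KS.le_prB0 κ Φ t p O.merged mkP
  have hfx : KS.Rs t O.merged mkP + KS0.R'0 κ Φ t p O.merged mkP + KS.prB0 κ Φ t p O.merged mkP + 1 ≤ fOf κ Φ t p O fv := by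
    have h := hf; rw [KS.fxR0_eq] at h; exact h
  have hML := (ML_le_ML κ Φ t p O.merged (gOf κ Φ t p O gv)).2
  have hsL := ML_sub_one_le_kgSL κ Φ t p O.merged (gOf κ Φ t p O gv) (fOf κ Φ t p O fv) hN
  have hW : ((KS.prB0 κ Φ t p O.merged mkP : ℕ) : ℤ) + (KS.ℓB0 κ Φ t p O.merged mkP) + 5 * (KS0.R'0 κ Φ t p O.merged mkP : ℤ) + 2 ≤ (kgW κ Φ t p O.merged (gOf κ Φ t p O gv) (fOf κ Φ t p O fv) 0 : ℕ) := by
    have h1 : ((ML κ Φ t p O.merged (gOf κ Φ t p O gv) : ℕ) : ℤ) - 1 ≤ (kgW κ Φ t p O.merged (gOf κ Φ t p O gv) (fOf κ Φ t p O fv) 0 : ℕ) := by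
      unfold kgW; push_cast; rw [Int.toNat_of_nonneg hsL0]; linarith
    have h2 : ((gOf κ Φ t p O gv : ℕ) : ℤ) ≤ ((ML κ Φ t p O.merged (gOf κ Φ t p O gv) : ℕ) : ℤ) := by exact_mod_cast hML
    have h3 : 2 * ((fOf κ Φ t p O fv : ℕ) : ℤ) + 5 * (KS0.R'0 κ Φ t p O.merged mkP : ℤ) + 3 ≤ ((gOf κ Φ t p O gv : ℕ) : ℤ) := by exact_mod_cast hfg
    have h4n : KS.prB0 κ Φ t p O.merged mkP + 1 ≤ fOf κ Φ t p O fv := by have := hfx; omega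
    have h4 : ((KS.prB0 κ Φ t p O.merged mkP : ℕ) : ℤ) + 1 ≤ ((fOf κ Φ t p O fv : ℕ) : ℤ) := by exact_mod_cast h4n
    have h5n : 3 * KS.ℓB0 κ Φ t p O.merged mkP ≤ KS.prB0 κ Φ t p O.merged mkP := by have := hprB.2; omega
    have h5 : 3 * ((KS.ℓB0 κ Φ t p O.merged mkP : ℕ) : ℤ) ≤ ((KS.prB0 κ Φ t p O.merged mkP : ℕ) : ℤ) := by exact_mod_cast h5n
    linarith
  have hRq : KS0.R'0 κ Φ t p O.merged mkP ≤ kgq κ Φ t p O.merged (gOf κ Φ t p O gv) (fOf κ Φ t p O fv) 0 := by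
    unfold kgq; omega
  -- the PREFIX depth row: `D0s(2n_L) + 13·reach(prefix) ≤ D0s + ZDP ≤ Rπ`
  have hreachP := KS.reachP_le κ Φ t p O.merged mkP (gOf κ Φ t p O gv) (fOf κ Φ t p O fv) hN hgK hg2
  have hRD : ((KS.D0s κ Φ t p O.merged mkP (gOf κ Φ t p O gv) (fOf κ Φ t p O fv) (kgq κ Φ t p O.merged (gOf κ Φ t p O gv) (fOf κ Φ t p O fv) 0) : ℕ) : ℤ) +
      (10 + 3) * ((((30 : ℕ) : ℤ) + 1) * ((nL κ Φ t p O.merged (gOf κ Φ t p O gv) (fOf κ Φ t p O fv)) : ℤ) +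
        kgZ₀ (nL κ Φ t p O.merged (gOf κ Φ t p O gv) (fOf κ Φ t p O fv)) (vL κ Φ t p O.merged (gOf κ Φ t p O gv) (fOf κ Φ t p O fv)) (KS0.R'0 κ Φ t p O.merged mkP) 0 (kgq κ Φ t p O.merged (gOf κ Φ t p O gv) (fOf κ Φ t p O fv) 0) 30
          (kgM₁ (nL κ Φ t p O.merged (gOf κ Φ t p O gv) (fOf κ Φ t p O fv)) (ℓL κ Φ t p O.merged (gOf κ Φ t p O gv) (fOf κ Φ t p O fv)) (hL κ Φ t p O.merged (gOf κ Φ t p O gv) (fOf κ Φ t p O fv)) (KS0.R'0 κ Φ t p O.merged mkP) 0 (kgW κ Φ t p O.merged (gOf κ Φ t p O gv) (fOf κ Φ t p O fv) 0) 30)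
          (kgM₂ (nL κ Φ t p O.merged (gOf κ Φ t p O gv) (fOf κ Φ t p O fv)) (ℓL κ Φ t p O.merged (gOf κ Φ t p O gv) (fOf κ Φ t p O fv)) (hL κ Φ t p O.merged (gOf κ Φ t p O gv) (fOf κ Φ t p O fv)) (vL κ Φ t p O.merged (gOf κ Φ t p O gv) (fOf κ Φ t p O fv)) (KS0.R'0 κ Φ t p O.merged mkP) 0 (kgq κ Φ t p O.merged (gOf κ Φ t p O gv) (fOf κ Φ t p O fv) 0) (kgW κ Φ t p O.merged (gOf κ Φ t p O gv) (fOf κ Φ t p O fv) 0) 30) +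
        kgZ₁ (nL κ Φ t p O.merged (gOf κ Φ t p O gv) (fOf κ Φ t p O fv)) (ℓL κ Φ t p O.merged (gOf κ Φ t p O gv) (fOf κ Φ t p O fv)) (hL κ Φ t p O.merged (gOf κ Φ t p O gv) (fOf κ Φ t p O fv)) (KS0.R'0 κ Φ t p O.merged mkP) 0 (kgW κ Φ t p O.merged (gOf κ Φ t p O gv) (fOf κ Φ t p O fv) 0) 30
          (kgM₁ (nL κ Φ t p O.merged (gOf κ Φ t p O gv) (fOf κ Φ t p O fv)) (ℓL κ Φ t p O.merged (gOf κ Φ t p O gv) (fOf κ Φ t p O fv)) (hL κ Φ t p O.merged (gOf κ Φ t p O gv) (fOf κ Φ t p O fv)) (KS0.R'0 κ Φ t p O.merged mkP) 0 (kgW κ Φ t p O.merged (gOf κ Φ t p O gv) (fOf κ Φ t p O fv) 0) 30)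
          (kgWm₂ (nL κ Φ t p O.merged (gOf κ Φ t p O gv) (fOf κ Φ t p O fv)) (ℓL κ Φ t p O.merged (gOf κ Φ t p O gv) (fOf κ Φ t p O fv)) (hL κ Φ t p O.merged (gOf κ Φ t p O gv) (fOf κ Φ t p O fv)) (KS0.R'0 κ Φ t p O.merged mkP) 0 (kgW κ Φ t p O.merged (gOf κ Φ t p O gv) (fOf κ Φ t p O fv) 0) 30)
          (kgWp₂ (nL κ Φ t p O.merged (gOf κ Φ t p O gv) (fOf κ Φ t p O fv)) (ℓL κ Φ t p O.merged (gOf κ Φ t p O gv) (fOf κ Φ t p O fv)) (hL κ Φ t p O.merged (gOf κ Φ t p O gv) (fOf κ Φ t p O fv)) (KS0.R'0 κ Φ t p O.merged mkP) 0 (kgW κ Φ t p O.merged (gOf κ Φ t p O gv) (fOf κ Φ t p O fv) 0) 30)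
          (kgM₂ (nL κ Φ t p O.merged (gOf κ Φ t p O gv) (fOf κ Φ t p O fv)) (ℓL κ Φ t p O.merged (gOf κ Φ t p O gv) (fOf κ Φ t p O fv)) (hL κ Φ t p O.merged (gOf κ Φ t p O gv) (fOf κ Φ t p O fv)) (vL κ Φ t p O.merged (gOf κ Φ t p O gv) (fOf κ Φ t p O fv)) (KS0.R'0 κ Φ t p O.merged mkP) 0 (kgq κ Φ t p O.merged (gOf κ Φ t p O gv) (fOf κ Φ t p O fv) 0) (kgW κ Φ t p O.merged (gOf κ Φ t p O gv) (fOf κ Φ t p O fv) 0) 30)) ≤ (Rπ κ Φ t p O.merged (gOf κ Φ t p O gv) (fOf κ Φ t p O fv) (SUS ex mx) q) := by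
    have h1 : ((KS.D0s κ Φ t p O.merged mkP (gOf κ Φ t p O gv) (fOf κ Φ t p O fv) (kgq κ Φ t p O.merged (gOf κ Φ t p O gv) (fOf κ Φ t p O fv) 0) : ℕ) : ℤ) + (KS.ZDP κ Φ t p O.merged (gOf κ Φ t p O gv) (fOf κ Φ t p O fv) : ℤ) ≤ (Rπ κ Φ t p O.merged (gOf κ Φ t p O gv) (fOf κ Φ t p O fv) (SUS ex mx) q) := by
      exact_mod_cast hPπ
    have e : ((10 : ℤ) + 3) = 13 := by norm_num
    rw [e]
    unfold kgR at hreachP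
    push_cast at hreachP ⊢
    linarith
  -- the y′-corridor depth row: `D2R + 13·reach(y′, reduced window) ≤ D2R + ZY + 13·n_L ≤ Rπ`
  have hreachY := KS.reachRY_le κ Φ t p O.merged mkP (gOf κ Φ t p O gv) (fOf κ Φ t p O fv) qxY WxY hN hgK (ZY : ℤ) hZY
  have hRD₃ : ((KS.D2R κ Φ t p O.merged mkP (gOf κ Φ t p O gv) (fOf κ Φ t p O fv) WxY : ℕ) : ℤ) + (10 + 3) * ((((((kgNYv0 κ Φ t p O.merged (gOf κ Φ t p O gv) (fOf κ Φ t p O fv) mkP qxY WxY) : ℕ)) : ℤ) + 1) * ((((nL κ Φ t p O.merged (gOf κ Φ t p O gv) (fOf κ Φ t p O fv)) * (ℓL κ Φ t p O.merged (gOf κ Φ t p O gv) (fOf κ Φ t p O fv)) / Skelφ.shearUnit (nL κ Φ t p O.merged (gOf κ Φ t p O gv) (fOf κ Φ t p O fv)) (hL κ Φ t p O.merged (gOf κ Φ t p O gv) (fOf κ Φ t p O fv)) + 1 : ℕ)) : ℤ) + (kgZY₀ (nL κ Φ t p O.merged (gOf κ Φ t p O gv) (fOf κ Φ t p O fv)) (vL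 κ Φ t p O.merged (gOf κ Φ t p O gv) (fOf κ Φ t p O fv)) (KS0.R'0 κ Φ t p O.merged mkP) 0 (kgWY κ Φ t p O.merged (gOf κ Φ t p O gv) (fOf κ Φ t p O fv) (KS.WxYR κ Φ t p O.merged mkP (gOf κ Φ t p O gv) (fOf κ Φ t p O fv) WxY)) (kgNYv0 κ Φ t p O.merged (gOf κ Φ t p O gv) (fOf κ Φ t p O fv) mkP qxY WxY) (kgM₁Y (nL κ Φ t p O.merged (gOf κ Φ t p O gv) (fOf κ Φ t p O fv)) (vL κ Φ t p O.merged (gOf κ Φ t p O gv) (fOf κ Φ t p O fv)) (KS0.R'0 κ Φ t p O.merged mkP) 0 (kgWY κ Φ t p O.merged (gOf κ Φ t p O gv) (fOf κ Φ t p O fv) (KS.WxYR κ Φ t p O.merged mkP (gOf κ Φ t p O gv) (fOf κ Φ t p O fv) WxY)) (kgNYv0 κ Φ t p O.merged (gOf κ Φ t p O gv) (fOf κ Φ t p O fv) mkP qxY WxY)) (kgWm₂Y (nL κ Φ t p O.merged (gOf κ Φ t p O gv) (fOf κ Φ t p O fv)) (vL κ Φ t p O.merged (gOf κ Φ t p O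 gv) (fOf κ Φ t p O fv)) (KS0.R'0 κ Φ t p O.merged mkP) 0 (kgWY κ Φ t p O.merged (gOf κ Φ t p O gv) (fOf κ Φ t p O fv) (KS.WxYR κ Φ t p O.merged mkP (gOf κ Φ t p O gv) (fOf κ Φ t p O fv) WxY)) (kgNYv0 κ Φ t p O.merged (gOf κ Φ t p O gv) (fOf κ Φ t p O fv) mkP qxY WxY)) (kgWp₂Y (nL κ Φ t p O.merged (gOf κ Φ t p O gv) (fOf κ Φ t p O fv)) (vL κ Φ t p O.merged (gOf κ Φ t p O gv) (fOf κ Φ t p O fv)) (KS0.R'0 κ Φ t p O.merged mkP) 0 (kgWY κ Φ t p O.merged (gOf κ Φ t p O gv) (fOf κ Φ t p O fv) (KS.WxYR κ Φ t p O.merged mkP (gOf κ Φ t p O gv) (fOf κ Φ t p O fv) WxY)) (kgNYv0 κ Φ t p O.merged (gOf κ Φ t p O gv) (fOf κ Φ t p O fv) mkP qxY WxY)) (kgM₂Y (nL κ Φ t p O.merged (gOf κ Φ t p O gv) (fOf κ Φ t p O fv)) (ℓL κ Φ t p O.merged (gOf κ Φ t p O gv) (fOf κ Φ t p O fv)) (hL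 κ Φ t p O.merged (gOf κ Φ t p O gv) (fOf κ Φ t p O fv)) (vL κ Φ t p O.merged (gOf κ Φ t p O gv) (fOf κ Φ t p O fv)) (KS0.R'0 κ Φ t p O.merged mkP) 0 (kgqY κ Φ t p O.merged (gOf κ Φ t p O gv) (fOf κ Φ t p O fv) qxY) (kgWY κ Φ t p O.merged (gOf κ Φ t p O gv) (fOf κ Φ t p O fv) (KS.WxYR κ Φ t p O.merged mkP (gOf κ Φ t p O gv) (fOf κ Φ t p O fv) WxY)) (kgNYv0 κ Φ t p O.merged (gOf κ Φ t p O gv) (fOf κ Φ t p O fv) mkP qxY WxY))) + (kgZY₁ (nL κ Φ t p O.merged (gOf κ Φ t p O gv) (fOf κ Φ t p O fv)) (ℓL κ Φ t p O.merged (gOf κ Φ t p O gv) (fOf κ Φ t p O fv)) (hL κ Φ t p O.merged (gOf κ Φ t p O gv) (fOf κ Φ t p O fv)) (KS0.R'0 κ Φ t p O.merged mkP) 0 (kgqY κ Φ t p O.merged (gOf κ Φ t p O gv) (fOf κ Φ t p O fv) qxY) (kgNYv0 κ Φ t p O.merged (gOf κ Φ t p O gv) (fOf κ Φ t p O fv)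 mkP qxY WxY) (kgM₁Y (nL κ Φ t p O.merged (gOf κ Φ t p O gv) (fOf κ Φ t p O fv)) (vL κ Φ t p O.merged (gOf κ Φ t p O gv) (fOf κ Φ t p O fv)) (KS0.R'0 κ Φ t p O.merged mkP) 0 (kgWY κ Φ t p O.merged (gOf κ Φ t p O gv) (fOf κ Φ t p O fv) (KS.WxYR κ Φ t p O.merged mkP (gOf κ Φ t p O gv) (fOf κ Φ t p O fv) WxY)) (kgNYv0 κ Φ t p O.merged (gOf κ Φ t p O gv) (fOf κ Φ t p O fv) mkP qxY WxY)) (kgM₂Y (nL κ Φ t p O.merged (gOf κ Φ t p O gv) (fOf κ Φ t p O fv)) (ℓL κ Φ t p O.merged (gOf κ Φ t p O gv) (fOf κ Φ t p O fv)) (hL κ Φ t p O.merged (gOf κ Φ t p O gv) (fOf κ Φ t p O fv)) (vL κ Φ t p O.merged (gOf κ Φ t p O gv) (fOf κ Φ t p O fv)) (KS0.R'0 κ Φ t p O.merged mkP) 0 (kgqY κ Φ t p O.merged (gOf κ Φ t p O gv) (fOf κ Φ t p O fv) qxY) (kgWY κ Φ t p O.merged (gOf κ Φ t p O gv) (fOf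 κ Φ t p O fv) (KS.WxYR κ Φ t p O.merged mkP (gOf κ Φ t p O gv) (fOf κ Φ t p O fv) WxY)) (kgNYv0 κ Φ t p O.merged (gOf κ Φ t p O gv) (fOf κ Φ t p O fv) mkP qxY WxY)))) ≤ (Rπ κ Φ t p O.merged (gOf κ Φ t p O gv) (fOf κ Φ t p O fv) (SUS ex mx) q) := by
    have h1 : ((KS.D2R κ Φ t p O.merged mkP (gOf κ Φ t p O gv) (fOf κ Φ t p O fv) WxY : ℕ) : ℤ) + (ZY : ℤ) + 13 * ((nL κ Φ t p O.merged (gOf κ Φ t p O gv) (fOf κ Φ t p O fv)) : ℤ) ≤ (Rπ κ Φ t p O.merged (gOf κ Φ t p O gv) (fOf κ Φ t p O fv) (SUS ex mx) q) := by exact_mod_cast hYπ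
    have e : ((10 : ℤ) + 3) = 13 := by norm_num
    rw [e]
    unfold kgR at hreachY
    linarith
  -- assemble: the skeleton at the values of record
  have HKx := kgRows0_of κ Φ t p O.merged (gOf κ Φ t p O gv) (fOf κ Φ t p O fv) mkP 0 0 (eqNumL_of_atQ (atQ3_of_atQ3V hAt)) hgK
  have HKy := kgYRows0_of κ Φ t p O.merged (gOf κ Φ t p O gv) (fOf κ Φ t p O fv) mkP qxY (KS.WxYR κ Φ t p O.merged mkP (gOf κ Φ t p O gv) (fOf κ Φ t p O fv) WxY) (eqNumL_of_atQ (atQ3_of_atQ3V hAt)) hgK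
  have hmain := rootLegAt_frmQ3KV_sndPx LfQ hAt hP hp0 hp1 mk hnL hnK hDk O.merged mkP hRK HKx 30 HKy (kgNYv0 κ Φ t p O.merged (gOf κ Φ t p O gv) (fOf κ Φ t p O fv) mkP qxY WxY)
    (Rb := KS.RB0 κ Φ t p O.merged mkP + D) hr₀R hr₀bR
    (hRQ_RT κ Φ t p O.merged (gOf κ Φ t p O gv) (fOf κ Φ t p O fv) (cOf κ Φ t p O gv fv cv) (SUS ex mx) q)
    (hRB_RT κ Φ t p O.merged (gOf κ Φ t p O gv) (fOf κ Φ t p O fv) (cOf κ Φ t p O gv fv cv) (SUS ex mx) q _)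
    (hRQ'_RT κ Φ t p O.merged (gOf κ Φ t p O gv) (fOf κ Φ t p O fv) (cOf κ Φ t p O gv fv cv) (SUS ex mx) q _)
    (hRM_RT κ Φ t p O.merged (gOf κ Φ t p O gv) (fOf κ Φ t p O fv) (cOf κ Φ t p O gv fv cv) (SUS ex mx) q _)
    hρπD
    (fun i => by rw [fcellsV_r]; exact hRs5 i)
    (hkR_hop_prism κ Φ t p O.merged (gOf κ Φ t p O gv) (fOf κ Φ t p O fv) hN)
    (by
      have h := hfR_hop_snd κ Φ t p O.merged (gOf κ Φ t p O gv) (fOf κ Φ t p O fv) hN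
        (c₁ := (fcellsV κ Φ t p O.merged (gOf κ Φ t p O gv) (fOf κ Φ t p O fv) (cOf κ Φ t p O gv fv cv) (hOf κ Φ t p O gv fv hv)).c 1) ((fcellsV κ Φ t p O.merged (gOf κ Φ t p O gv) (fOf κ Φ t p O fv) (cOf κ Φ t p O gv fv cv) (hOf κ Φ t p O gv fv hv)).hcr 1)
      simpa only [fcellsV_r] using h)
    c₁ hc₁ hRD hnR hrow
    (by rw [hX1]; exact KS.hX₁_0 κ Φ t p O.merged mkP (gOf κ Φ t p O gv) (fOf κ Φ t p O fv) _)
    c₂ hc₂ hRD₃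
    (KS.B0 κ Φ t p O.merged mkP (gOf κ Φ t p O gv) (fOf κ Φ t p O fv)) (B0_ok_of_atQ3 hAt' mkP)
    (KS.B0_lo_le_hi κ Φ t p O.merged mkP (gOf κ Φ t p O gv) (fOf κ Φ t p O fv))
    (KS.R'0_le_B0_R' κ Φ t p O.merged mkP (gOf κ Φ t p O gv) (fOf κ Φ t p O fv))
    (KS.B0_core1_le κ Φ t p O.merged mkP (gOf κ Φ t p O gv) (fOf κ Φ t p O fv) hℓB3) hc1R
    (KS.hhopB_0 κ Φ t p O.merged mkP (gOf κ Φ t p O gv) (fOf κ Φ t p O fv) _ _ hn1)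
    (KS.hclear₁_0_of_floor κ Φ t p O.merged mkP (gOf κ Φ t p O gv) (fOf κ Φ t p O fv) hf)
    _ _ hQb hFb hbridge
    hfoot₁ (hfoot₂ c₁ hX1 hY1) (hfoot₃ c₂ hX2 hY2)
    (fun k hk w _ hw => KS.hclear₃_RW κ Φ t p O.merged mkP (gOf κ Φ t p O gv) (fOf κ Φ t p O fv) qxY WxY hN hgK hg2 hgR hWxY hqx20 h0Y hXY hX2 hY2 k hk w hw)
    (fun w _ hw => KS.hx_0s κ Φ t p O.merged mkP (gOf κ Φ t p O gv) (fOf κ Φ t p O fv) _ hN HKx 30 hW hRq hX1 hY1 hw)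
    (fun w _ hw => KS.hx₂_R κ Φ t p O.merged mkP (gOf κ Φ t p O gv) (fOf κ Φ t p O fv) qxY WxY hN hgK hg2 hf hWxY hWx45 hq3 hX1 hY1 hX2 hY2 hw)
    (hlastf c₂ hX2 hY2)
    hDm
    (hR₁_US κ Φ t p O.merged (gOf κ Φ t p O gv) (fOf κ Φ t p O fv) ex mx q hCq (oL κ Φ t p O.D O.DT.toDataN O.ori (gOf κ Φ t p O gv) (fOf κ Φ t p O fv)) hη t
      (D + Skelφ.fatRadius Φ.frame hC O.merged.k))
    (hRexD hexRB)
    (hRexD hexRL)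
    (by
      rw [ChainPlanar.BridgePrm.bridgeFrame_N]
      exact KS.hlen_R2 κ Φ t p O.merged mkP (gOf κ Φ t p O gv) (fOf κ Φ t p O fv) qxY WxY hN hgK hg2 hxY)
  exact hmain

end NegB

end PlanarSkeletonFrmFrom

end Transplant

end Summit.CriticalPhenomena.PercolationContinuityZ3.Theorems

end
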